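import Literature.AnabelianGeometry.EtaleTheta.Discharge.Sec2Cor219iTrivialBase
import HarnessLib

/-!
# [EtTh] Cor. 2.19 (i) (cyclotomic rigidity) HOLDS at the discrete Heisenberg skeleton of `(Π^tp_X)^Θ` — FACT
# rows F-0626 `Cor219_i_splittings` / F-0627 `Cor219_i_subquotients` instance-PROVED at a datum with `μ_3 ≠ 1`,
# `D_Y ≠ 1`, where temp-slimness (F-0622) and F-0623 FAIL (proof-only)

S. Mochizuki, *The Étale Theta Function …* [EtTh], Publ. RIMS **45** (2009), §1 p. 35 (`l·Δ_Θ ⊆ [Δ^Θ, Δ^Θ]`),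
§2 Def. 2.13 p. 47, Prop. 2.14 (i) p. 49, Cor. 2.18 (iii) p. 61, Cor. 2.19 (i) pp. 64–66 ("the subquotients …" and
"the two splittings `s^alg`, `s^Θ`" are preserved by automorphisms of a mono-theta environment) (locators `p.N` =
PDF pages; bib key `MochizukiEtTh2009`).

PROOF-ONLY (no `def`, no instance, no new named fact; cell `abc-iut`, seat abc-iut-w6-d089).  abc-iut-w5-d175
showed the universal closures of both rows are kernel-false (`ThetaRigiditySchemaWitness.lean`, abelian toys with
`D_Y = 1`); lane C2 (abc-iut-L2-d1, `cor219_i_subquotients_of` / `cor219_i_splittings_of`) discharges them modulo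
F-0620 `Cor218_i` ∧ F-0622 `Cor218_iii_PiX` (temp-slimness) ∧ F-0623 `Cor218_iii_quotient` (∧ F-0631).  Here the
SAME toy as abc-iut-f-151's `exists_rigidData_prop214_i` (p441638) — `Π^tp_X := ℤ² ⋊ ℤ` (`a·bᵝcᵞ·a⁻¹ =
bᵝcᵞ⁺ᵝ`), `Π^tp_Y = ⟨b, c⟩`, `Π^tp_Ÿ = ⟨b², c⟩`, `G_K = 1`, `μ_3`, `(l·Δ_Θ) := ⟨c⟩`, `Ker(Π ↠ Π^Θ) := 1`,
`thetaMod = η₀ : cᵞ ↦ γ mod 3` (REBUILT inside the proof: a proof-only file cannot name it) — satisfies,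
UNCONDITIONALLY, **`exists_rigidData_cor219_i`**: `|μ| = 3`, `Π^tp_Y` commutative, `D_Y ≠ 1`, and
* `¬ Cor218_iii_PiX` (`c ≠ 1` is central) and `¬ Cor218_iii_quotient` (the envelope `μ_3 × Π^tp_Y` is abelian,
  so the union of centralisers of open subgroups is everything) — the lane-C2 dischargers' hypotheses FAIL;
* `Cor219_i_subquotients` AND `Cor219_i_splittings` — by the `G_K = 1` commutator criteria of
  `Discharge/Sec2Cor219iTrivialBase.lean` (`[Π^tp_X, Π^tp_Y] ⊆ ⟨c⟩ = {[a, bᵏ]}`, `Π^tp_Y = ℤ²` torsion-free):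
  every model automorphism `α` preserves `s^alg(⟨c⟩)`, `s^Θ(⟨c⟩)`, `μ_3·s^alg(⟨c⟩)`, because `α∘conj_a∘α⁻¹` is
  a `D_Y`-class and `D_Y`-classes act as `id × conj_g` — print's MECHANISM of Prop. 2.14 (i).

So the two rows are STRICTLY WEAKER than the conjunction of their typed dischargers' hypotheses.  HONEST FRAMING:
statements about the cell's own typing at one explicit toy; nothing here bears on [EtTh] (refereed) or on
[IUTchIII] Cor. 3.12; no side taken; typed ≠ proved.
-/

namespace Literature.AnabelianGeometry.EtaleTheta

namespace RigidData

/-- **F-0626 / F-0627 at the Heisenberg skeleton.**  There is a `RigidData 3 1` — `Π^tp_X := ℤ² ⋊ ℤ`,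
`Π^tp_Y := ⟨b, c⟩`, `Π^tp_Ÿ := ⟨b², c⟩`, `(l·Δ_Θ) := ⟨c⟩`, `G_K := 1`, `μ_3`, `thetaMod = η₀ : cᵞ ↦ γ mod 3`
(abc-iut-f-151's datum of `exists_rigidData_prop214_i`, rebuilt) — with `|μ| = 3`, `Π^tp_Y` commutative,
`D_Y ≠ 1`, at which `Cor218_iii_PiX` and `Cor218_iii_quotient` FAIL while `Cor219_i_subquotients` and
`Cor219_i_splittings` HOLD. [cite: MochizukiEtTh2009, Cor 2.19(i) p.64] -/
theorem exists_rigidData_cor219_i :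
    ∃ R : RigidData.{0} 3 1, Fintype.card R.mu = 3 ∧ (∀ x y : R.PiY, x * y = y * x) ∧ R.DY ≠ ⊥ ∧
      ¬ Literature.AnabelianGeometry.EtaleTheta.RigidData.Cor218_iii_PiX R ∧
      ¬ Literature.AnabelianGeometry.EtaleTheta.RigidData.Cor218_iii_quotient R ∧
      Literature.AnabelianGeometry.EtaleTheta.RigidData.Cor219_i_subquotients R ∧
      Literature.AnabelianGeometry.EtaleTheta.RigidData.Cor219_i_splittings R := by
  -- §0. The datum: VERBATIM the construction of abc-iut-f-151's `exists_rigidData_prop214_i`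
  -- (ThetaRigidityHeisenbergProp214i.lean), which a proof-only file cannot name.
  classical
  -- the lattice `ℤ² = ⟨b, c⟩` (written multiplicatively) and the unipotent `u : (β, γ) ↦ (β, γ + β)`
  let V : Type := Multiplicative (ℤ × ℤ)
  let uA : ℤ × ℤ ≃+ ℤ × ℤ :=
    { toFun := fun v => (v.1, v.2 + v.1)
      invFun := fun v => (v.1, v.2 - v.1)
      left_inv := fun v => by ext <;> simp
      right_inv := fun v => by ext <;> simp
      map_add' := fun v w => by ext <;> simp only [Prod.fst_add, Prod.snd_add]; ring }
  let u : V ≃* V := AddEquiv.toMultiplicative uA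
  let φ : Multiplicative ℤ →* MulAut V := zpowersHom (MulAut V) u
  -- every `φ g = u^k` preserves the `b`-coordinate and fixes the `c`-line
  have huA : ∀ v : V, Multiplicative.toAdd (u v) =
      ((Multiplicative.toAdd v).1, (Multiplicative.toAdd v).2 + (Multiplicative.toAdd v).1) := fun v => rfl
  let S : Subgroup (MulAut V) :=
    { carrier := {e | (∀ v, (Multiplicative.toAdd (e v)).1 = (Multiplicative.toAdd v).1) ∧
        ∀ t : ℤ, e (Multiplicative.ofAdd ((0 : ℤ), t)) = Multiplicative.ofAdd ((0 : ℤ), t)}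
      mul_mem' := fun {e e'} he he' => ⟨fun v => by
          change (Multiplicative.toAdd (e (e' v))).1 = _
          rw [he.1, he'.1], fun t => by
          change e (e' _) = _
          rw [he'.2, he.2]⟩
      one_mem' := ⟨fun v => rfl, fun t => rfl⟩
      inv_mem' := fun {e} he => ⟨fun v => by
          have h := he.1 (e⁻¹ v)
          rw [MulAut.apply_inv_self] at h
          exact h.symm, fun t => by
          have h := congrArg (fun v => e⁻¹ v) (he.2 t)
          simp only [MulAut.inv_apply_self] at h
          exact h.symm⟩ }
  have huS : u ∈ S := ⟨fun v => rfl, fun t => by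
    apply Multiplicative.toAdd.injective
    rw [huA, toAdd_ofAdd]
    simp⟩
  have hφS : ∀ g : Multiplicative ℤ, φ g ∈ S := fun g => by
    change u ^ (Multiplicative.toAdd g) ∈ S
    exact S.zpow_mem huS _
  have hφ1 : ∀ (g : Multiplicative ℤ) (v : V),
      (Multiplicative.toAdd (φ g v)).1 = (Multiplicative.toAdd v).1 := fun g => (hφS g).1
  have hφ2 : ∀ (g : Multiplicative ℤ) (t : ℤ),
      φ g (Multiplicative.ofAdd ((0 : ℤ), t)) = Multiplicative.ofAdd ((0 : ℤ), t) := fun g => (hφS g).2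
  -- the Heisenberg group `Π := ℤ² ⋊ ℤ`, discrete
  let P : Type := V ⋊[φ] Multiplicative ℤ
  letI : TopologicalSpace P := ⊥
  haveI : DiscreteTopology P := ⟨rfl⟩
  let PiY : Subgroup P := (SemidirectProduct.rightHom : P →* Multiplicative ℤ).ker
  have mem_PiY : ∀ x : P, x ∈ PiY ↔ x.right = 1 := fun x => Iff.rfl
  -- `β mod 2`, a homomorphism on all of `Π` (the `b`-coordinate is additive on `Π`)
  let L : P →* Multiplicative (ZMod 2) :=
    { toFun := fun x => Multiplicative.ofAdd (((Multiplicative.toAdd x.left).1 : ℤ) : ZMod 2)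
      map_one' := by simp
      map_mul' := fun x y => by
        rw [SemidirectProduct.mul_left, toAdd_mul, Prod.fst_add, hφ1, Int.cast_add, ofAdd_add] }
  let PiYdd : Subgroup P := L.ker ⊓ PiY
  let b₀ : V := Multiplicative.ofAdd ((1 : ℤ), (0 : ℤ))
  let c₀ : V := Multiplicative.ofAdd ((0 : ℤ), (1 : ℤ))
  let a : P := SemidirectProduct.inr (Multiplicative.ofAdd (1 : ℤ))
  have hinl_mem : ∀ v : V, (SemidirectProduct.inl v : P) ∈ PiY := fun v => by
    rw [mem_PiY, SemidirectProduct.right_inl]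
  have hc_dd : (SemidirectProduct.inl c₀ : P) ∈ PiYdd := by
    refine ⟨?_, hinl_mem c₀⟩
    change L (SemidirectProduct.inl c₀) = 1
    simp [L, c₀]
  have hφa : φ (Multiplicative.ofAdd (1 : ℤ)) = u := by
    change u ^ Multiplicative.toAdd (Multiplicative.ofAdd (1 : ℤ)) = u
    rw [toAdd_ofAdd, zpow_one]
  have hub : u b₀ = b₀ * c₀ := rfl
  have haba : a * SemidirectProduct.inl b₀ * a⁻¹ =
      (SemidirectProduct.inl b₀ * SemidirectProduct.inl c₀ : P) := by
    rw [← map_inv, ← SemidirectProduct.inl_aut, hφa, hub, map_mul]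
  have hmul_left : ∀ x y : P, x ∈ PiY → (x * y).left = x.left * y.left := fun x y hx => by
    rw [SemidirectProduct.mul_left, (mem_PiY x).mp hx, map_one, MulAut.one_apply]
  have index_PiYdd : (PiYdd.subgroupOf PiY).index = 2 := by
    change PiYdd.relIndex PiY = 2
    rw [Subgroup.inf_relIndex_right, Subgroup.relIndex_ker]
    have hmap : PiY.map L = ⊤ := by
      have key : ∀ t : Multiplicative (ZMod 2), t = 1 ∨ t = Multiplicative.ofAdd 1 := by decide
      refine top_le_iff.mp fun t _ => ?_
      rcases key t with rfl | rfl
      · exact ⟨1, PiY.one_mem, map_one L⟩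
      · exact ⟨SemidirectProduct.inl b₀, hinl_mem b₀, by simp [L, b₀]⟩
    rw [hmap, Subgroup.card_top, Nat.card_eq_fintype_card]
    rfl
  haveI hPiYdd_normal : PiYdd.Normal := inferInstance
  let q : P → Multiplicative (ZMod 3) := fun x => Multiplicative.ofAdd (((Multiplicative.toAdd x.left).2 : ℤ) : ZMod 3)
  have q_mul : ∀ x y : P, x ∈ PiY → q (x * y) = q x * q y := fun x y hx => by
    change Multiplicative.ofAdd ((((Multiplicative.toAdd (x * y).left).2 : ℤ) : ZMod 3)) = _
    rw [hmul_left x y hx, toAdd_mul, Prod.snd_add, Int.cast_add, ofAdd_add]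
  let η₀ : PiYdd → Multiplicative (ZMod 3) := fun y => q y
  have hinl : ∀ y : P, y ∈ PiY → SemidirectProduct.inl y.left = y := fun y hy =>
    SemidirectProduct.ext (by simp) (by rw [SemidirectProduct.right_inl, (mem_PiY y).mp hy])
  have hv : ∀ β δ : ℤ, (SemidirectProduct.inl (Multiplicative.ofAdd (β, δ)) : P) =
      SemidirectProduct.inl b₀ ^ β * SemidirectProduct.inl c₀ ^ δ := by
    intro β δ
    rw [← map_zpow (SemidirectProduct.inl : V →* P), ← map_zpow (SemidirectProduct.inl : V →* P),
      ← map_mul]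
    congr 1
    apply Multiplicative.toAdd.injective
    rw [toAdd_ofAdd, toAdd_mul, toAdd_zpow, toAdd_zpow]
    ext <;> simp [b₀, c₀]
  have hc_central : ∀ (t : ℤ) (w : P),
      SemidirectProduct.inl (Multiplicative.ofAdd ((0 : ℤ), t)) * w =
        w * SemidirectProduct.inl (Multiplicative.ofAdd ((0 : ℤ), t)) := by
    intro t w
    refine SemidirectProduct.ext ?_ ?_
    · rw [SemidirectProduct.mul_left, SemidirectProduct.mul_left, SemidirectProduct.left_inl,
        SemidirectProduct.right_inl, map_one, MulAut.one_apply, hφ2, mul_comm]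
    · rw [SemidirectProduct.mul_right, SemidirectProduct.mul_right, SemidirectProduct.right_inl,
        one_mul, mul_one]
  -- `(l·Δ_Θ) := ⟨c⟩`, central and inside `Π_Ÿ`
  let Lc : Subgroup P := Subgroup.zpowers (SemidirectProduct.inl c₀)
  have hc_pow : ∀ k : ℤ, (SemidirectProduct.inl c₀ : P) ^ k =
      SemidirectProduct.inl (Multiplicative.ofAdd ((0 : ℤ), k)) := fun k => by
    rw [hv 0 k, zpow_zero, one_mul]
  have hLc_dd : Lc ≤ PiYdd := by
    refine (Subgroup.zpowers_le).mpr ?_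
    exact hc_dd
  have hLc_Y : Lc ≤ PiY := hLc_dd.trans inf_le_right
  have hLc_normal : Lc.Normal := ⟨fun g hg x => by
    obtain ⟨k, rfl⟩ := Subgroup.mem_zpowers_iff.mp hg
    rw [hc_pow, ← hc_central, mul_inv_cancel_right, ← hc_pow]
    exact Subgroup.zpow_mem_zpowers _ _⟩
  have hq_cpow : ∀ k : ℤ, q ((SemidirectProduct.inl c₀ : P) ^ k) = Multiplicative.ofAdd ((k : ℤ) : ZMod 3) :=
    fun k => by rw [hc_pow]; rfl
  let R : RigidData.{0} 3 1 :=
    { PiX := P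
      G := PUnit
      aug := 1
      aug_surjective := fun _ => ⟨1, Subsingleton.elim _ _⟩
      PiY := PiY
      PiY_normal := MonoidHom.normal_ker _
      PiY_open := isOpen_discrete _
      galYX := QuotientGroup.quotientKerEquivOfSurjective _ SemidirectProduct.rightHom_surjective
      PiYdd := PiYdd
      PiYdd_le := inf_le_right
      PiYdd_normal := hPiYdd_normal
      PiYdd_open := isOpen_discrete _
      index_PiYdd := index_PiYdd
      mu := Multiplicative (ZMod 3)
      mu_cyclic := inferInstance
      card_mu := rfl
      chi := 1
      chi_ker_open := isOpen_discrete _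
      thetaCocycles := {η₀}
      thetaCocycles_nonempty := Set.singleton_nonempty _
      isCocycle := by
        rintro η hη
        rw [Set.mem_singleton_iff] at hη
        subst hη
        intro x y
        change q ((x : P) * y) = q x * q y
        exact q_mul x y x.2.2
      locallyConstant := fun η _ => IsLocallyConstant.of_discrete η
      mul_coboundary_mem := by
        rintro η hη c
        rw [Set.mem_singleton_iff] at hη ⊢
        subst hη
        funext x
        simp [CycEnvelope.coboundary]
      thetaKer := ⊥
      thetaKer_normal := inferInstance
      thetaKer_le := bot_le
      lDeltaTheta := Lc
      thetaKer_le_lDeltaTheta := bot_le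
      lDeltaTheta_le := by
        rw [MonoidHom.ker_one]
        exact le_inf hLc_dd le_top
      lDeltaTheta_normal := hLc_normal
      thetaMod := MonoidHom.mk' (fun g => q g) (fun g h => q_mul g h (hLc_Y g.2))
      thetaMod_surjective := fun m => by
        obtain ⟨k, hk⟩ := ZMod.intCast_surjective (Multiplicative.toAdd m)
        refine ⟨⟨(SemidirectProduct.inl c₀ : P) ^ k, Subgroup.zpow_mem_zpowers _ _⟩, ?_⟩
        change q ((SemidirectProduct.inl c₀ : P) ^ k) = m
        rw [hq_cpow, hk]
        rfl
      thetaMod_ker := by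
        rintro ⟨g, hg⟩
        obtain ⟨j, rfl⟩ := Subgroup.mem_zpowers_iff.mp hg
        change q ((SemidirectProduct.inl c₀ : P) ^ j) = 1 ↔ _
        rw [hq_cpow, ofAdd_eq_one, ZMod.intCast_zmod_eq_zero_iff_dvd]
        constructor
        · rintro ⟨i, hi⟩
          refine ⟨1, Subgroup.one_mem _,
            ⟨(SemidirectProduct.inl c₀ : P) ^ i, Subgroup.zpow_mem_zpowers _ _⟩, ?_⟩
          change (SemidirectProduct.inl c₀ : P) ^ j =
            1 * ((SemidirectProduct.inl c₀ : P) ^ i) ^ ((3 : ℕ+) : ℕ)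
          rw [one_mul, ← zpow_natCast, ← zpow_mul, hi]
          congr 1
          norm_num [mul_comm]
        · rintro ⟨k, hk, ⟨h, hh⟩, hkh⟩
          rw [Subgroup.mem_bot] at hk
          subst hk
          obtain ⟨i, rfl⟩ := Subgroup.mem_zpowers_iff.mp hh
          have hkh' : (SemidirectProduct.inl c₀ : P) ^ j =
              ((SemidirectProduct.inl c₀ : P) ^ i) ^ ((3 : ℕ+) : ℕ) := by simpa using hkh
          rw [← zpow_natCast, ← zpow_mul, hc_pow, hc_pow] at hkh'
          have h4 := congrArg (fun x : P => (Multiplicative.toAdd x.left).2) hkh'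
          simp only [SemidirectProduct.left_inl, toAdd_ofAdd] at h4
          refine ⟨i, ?_⟩
          rw [h4]
          norm_num [mul_comm]
      thetaMod_conj := fun x g => by
        obtain ⟨k, hk⟩ := Subgroup.mem_zpowers_iff.mp g.2
        apply congrArg q
        change x * (g : P) * x⁻¹ = g
        rw [← hk, hc_pow, ← hc_central, mul_inv_cancel_right]
      cocycle_thetaKer := by
        rintro η hη y hy
        have h1 : η = η₀ := hη
        subst h1
        rw [Subgroup.mem_bot] at hy
        change q (y : P) = 1
        rw [hy]
        rfl
      cocycle_lDeltaTheta := by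
        rintro η hη y hy
        have h1 : η = η₀ := hη
        subst h1
        rfl
      cuspY := fun _ => ∅
      cuspX := fun _ => ∅
      cuspX_neg := fun _ => rfl
      augYdd_surjective := fun _ => ⟨1, Subsingleton.elim _ _⟩
      thetaSections_conj := by
        intro η η' hη hη'
        have h1 : η = η₀ := hη
        have h2 : η' = η₀ := hη'
        subst h1 h2
        exact ThetaEnvData.IsKLConjugate.base }
  let T : ThetaEnvData.{0} 3 := R.toThetaEnvData
  haveI hG : Subsingleton T.G := inferInstanceAs (Subsingleton PUnit)
  have hY_comm : ∀ x y : T.PiY, x * y = y * x := by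
    rintro ⟨x, hx⟩ ⟨y, hy⟩
    apply Subtype.ext
    change x * y = y * x
    refine SemidirectProduct.ext ?_ ?_
    · rw [hmul_left x y hx, hmul_left y x hy, mul_comm]
    · rw [SemidirectProduct.mul_right, SemidirectProduct.mul_right, (mem_PiY x).mp hx,
        (mem_PiY y).mp hy]
  -- the envelope `μ_3 × Π_Y` is abelian
  have henv_comm : ∀ x y : T.env, x * y = y * x := fun x y =>
    SemidirectProduct.ext (by rw [T.mul_left_eq, T.mul_left_eq, mul_comm]) (by
      rw [SemidirectProduct.mul_right, SemidirectProduct.mul_right, hY_comm])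
  -- §1. The three hypotheses of the commutator criteria
  -- (h1) `[Π_X, Π_Y] ⊆ ⟨c⟩`
  have hcomm0 : ∀ (g : P) (y : P), y ∈ PiY → g * y * g⁻¹ * y⁻¹ ∈ Lc := by
    let B : P →* Multiplicative ℤ :=
      { toFun := fun x => Multiplicative.ofAdd (Multiplicative.toAdd x.left).1
        map_one' := by simp
        map_mul' := fun x y => by
          rw [SemidirectProduct.mul_left, toAdd_mul, Prod.fst_add, hφ1, ofAdd_add] }
    intro g y hy
    have hY : g * y * g⁻¹ * y⁻¹ ∈ PiY :=
      PiY.mul_mem ((MonoidHom.normal_ker _).conj_mem _ hy g) (PiY.inv_mem hy)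
    have hB : B (g * y * g⁻¹ * y⁻¹) = 1 := by
      rw [map_mul, map_mul, map_mul, map_inv, map_inv, mul_inv_cancel_comm, mul_inv_cancel]
    have h1 : (Multiplicative.toAdd (g * y * g⁻¹ * y⁻¹).left).1 = 0 := by
      have := congrArg Multiplicative.toAdd hB
      simpa [B] using this
    have h3 : (g * y * g⁻¹ * y⁻¹).left =
        Multiplicative.ofAdd ((0 : ℤ), (Multiplicative.toAdd (g * y * g⁻¹ * y⁻¹).left).2) := by
      apply Multiplicative.toAdd.injective
      rw [toAdd_ofAdd]
      exact Prod.ext h1 rfl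
    rw [← hinl _ hY, h3, ← hc_pow]
    exact Subgroup.zpow_mem_zpowers _ _
  have hcomm : ∀ (g : R.PiX) (y : R.PiY), g * (y : R.PiX) * g⁻¹ * (y : R.PiX)⁻¹ ∈ R.lDeltaTheta :=
    fun g y => hcomm0 g y y.2
  -- (h2) `⟨c⟩ = {[a, bᵏ] : k ∈ ℤ}`
  have hconj : ∀ v : V, a * SemidirectProduct.inl v * a⁻¹ = SemidirectProduct.inl (u v) := fun v => by
    change SemidirectProduct.inr _ * _ * (SemidirectProduct.inr _)⁻¹ = (_ : P)
    rw [← map_inv, ← SemidirectProduct.inl_aut, hφa]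
  have hgen : ∀ w ∈ R.lDeltaTheta, ∃ y : R.PiY, a * (y : R.PiX) * a⁻¹ * (y : R.PiX)⁻¹ = w := by
    intro w hw
    obtain ⟨k, rfl⟩ := Subgroup.mem_zpowers_iff.mp hw
    refine ⟨⟨SemidirectProduct.inl (Multiplicative.ofAdd (k, (0 : ℤ))), hinl_mem _⟩, ?_⟩
    change a * SemidirectProduct.inl _ * a⁻¹ * (SemidirectProduct.inl _)⁻¹ = (_ : P)
    rw [hconj, ← map_inv, ← map_mul, hc_pow]
    congr 1
    apply Multiplicative.toAdd.injective
    rw [toAdd_mul, toAdd_inv, huA, toAdd_ofAdd, toAdd_ofAdd]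
    ext <;> simp
  -- (h3) `Π_Y = ℤ²` has no `3`-torsion
  have htf : ∀ y : R.PiY, y ^ ((3 : ℕ+) : ℕ) = 1 → y = 1 := by
    intro y hy
    have hx : (y : P) ^ ((3 : ℕ+) : ℕ) = 1 := by rw [← Subgroup.coe_pow, hy, Subgroup.coe_one]
    change (y : P) ^ 3 = 1 at hx
    have hx' : SemidirectProduct.inl ((y : P).left ^ 3) = (1 : P) := by
      rw [map_pow, hinl _ y.2]
      exact hx
    have h3 : (y : P).left ^ 3 = 1 := SemidirectProduct.inl_injective (hx'.trans (map_one _).symm)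
    have h5 : (3 : ℕ) • Multiplicative.toAdd (y : P).left = 0 := by rw [← toAdd_pow, h3, toAdd_one]
    have h51 : (3 : ℕ) • (Multiplicative.toAdd (y : P).left).1 = 0 := congrArg Prod.fst h5
    have h52 : (3 : ℕ) • (Multiplicative.toAdd (y : P).left).2 = 0 := congrArg Prod.snd h5
    rw [nsmul_eq_mul, Nat.cast_ofNat] at h51 h52
    have h6 : Multiplicative.toAdd (y : P).left = 0 :=
      Prod.ext (by change _ = (0 : ℤ); omega) (by change _ = (0 : ℤ); omega)
    have h7 : (y : P).left = 1 := Multiplicative.toAdd.injective (by rw [h6, toAdd_one])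
    apply Subtype.ext
    rw [← hinl _ y.2, h7, map_one]
    rfl
  -- §2. The conclusions
  refine ⟨R, rfl, hY_comm, fun hD => ?_, fun h => ?_, fun h => ?_,
    R.cor219_i_subquotients_of_commutators rfl hcomm a hgen htf,
    R.cor219_i_splittings_of_commutators hcomm a hgen htf⟩
  · -- `D_Y ≠ 1`: `[conj_a]` is not inner, since the envelope is abelian and `a b a⁻¹ ≠ b` (as in f-151's file)
    have hmem := T.mk_conjX_mem_DY a
    rw [hD, Subgroup.mem_bot] at hmem
    have hmem' : (⟨T.conjX a, T.conjX_mem_contMulAut a⟩ : contMulAut T.env) ∈ innerContAut T.env :=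
      (QuotientGroup.eq_one_iff _).mp hmem
    obtain ⟨e, he⟩ := (Subgroup.mem_subgroupOf.mp hmem' : _)
    have he' : MulAut.conj e = T.conjX a := he
    have hconj1 : T.conjX a = 1 := by
      rw [← he']
      refine MulEquiv.ext fun x => ?_
      rw [MulAut.conj_apply, henv_comm e x, mul_inv_cancel_right]
      rfl
    have h1 := congrArg (fun F : MulAut T.env =>
      (((F (CycEnvelope.algSection T.augY T.chi ⟨SemidirectProduct.inl b₀, hinl_mem b₀⟩)).right
        : T.PiY) : P)) hconj1
    change a * SemidirectProduct.inl b₀ * a⁻¹ = SemidirectProduct.inl b₀ at h1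
    rw [haba, ← map_mul] at h1
    have h2 : b₀ * c₀ = b₀ * 1 := (SemidirectProduct.inl_injective h1).trans (mul_one b₀).symm
    have h3 : c₀ = 1 := mul_left_cancel h2
    have h4 := congrArg (fun v : V => (Multiplicative.toAdd v).2) h3
    simp [c₀] at h4
  · -- `¬ Cor218_iii_PiX`: `c ≠ 1` is central
    have hc1 : (SemidirectProduct.inl c₀ : P) = 1 := h (SemidirectProduct.inl c₀) fun y => by
      have hcc : (SemidirectProduct.inl c₀ : P) = SemidirectProduct.inl (Multiplicative.ofAdd ((0 : ℤ), (1 : ℤ))) := rfl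
      rw [hcc, hc_central, mul_inv_cancel_right]
    have h4 := congrArg (fun v : V => (Multiplicative.toAdd v).2) (SemidirectProduct.inl_injective
      (hc1.trans (map_one _).symm))
    simp [c₀] at h4
  · -- `¬ Cor218_iii_quotient`: `s^alg(b)` centralises the (open) whole envelope but is not in `μ_3`
    have hs : CycEnvelope.algSection T.augY T.chi ⟨SemidirectProduct.inl b₀, hinl_mem b₀⟩ ∈
        centralizerUnion T.env :=
      ⟨⊤, by rw [Subgroup.coe_top]; exact isOpen_univ,
        Subgroup.mem_centralizer_iff.mpr fun g _ => henv_comm g _⟩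
    have h' : centralizerUnion T.env = (CycEnvelope.proj T.augY T.chi).ker := h
    rw [h', MonoidHom.mem_ker] at hs
    have h1 : (SemidirectProduct.inl b₀ : P) = 1 := congrArg (fun y : T.PiY => (y : P)) hs
    have h4 := congrArg (fun v : V => (Multiplicative.toAdd v).1) (SemidirectProduct.inl_injective
      (h1.trans (map_one _).symm))
    simp [b₀] at h4

end RigidData

end Literature.AnabelianGeometry.EtaleTheta
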